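import Literature.AlgebraicGeometry.HodgeTheory.PolarizationClassExistence
import HarnessLib

/-!
# Polarisation classes among the divisor classes (complement to `PolarizationClassExistence`)

Family `hodge`, layer `Literature/AlgebraicGeometry/HodgeTheory` (theorems only; no definition, no
named fact; net debt 0). Lane `lit-hodgefound`, queue row Q15 (= DAG-B v2 §8 item 5, ex-V-B5′ of
TRIBUNAL-B v1 §4). The existence statement itself — for `X` smooth projective of dimension `n` over `ℂ`
there is `η ∈ H²(X(ℂ); ℂ)` with `IsPolarizationClass n X η` — is the theorem
`exists_isPolarizationClass` of the sibling file `PolarizationClassExistence` (landed first, p249847;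
this file previously re-declared the same name and is reduced here to its complement so that the
umbrella `Literature` imports both files without a duplicate declaration).

What this file adds is the form in which André consumes the class: `η_X` is "la classe d'un quelconque
faisceau inversible ample" (André 1996, §1.1, p. 10), i.e. a RATIONAL class lying in
`N¹ H²(X(ℂ); ℂ) = algebraicClasses X 1` (the `ℂ`-span of divisor classes) which is a polarisation class
(hard Lefschetz in dimension `n`; Voisin I, Thm. 6.25 with Rem. 6.27, §7.1.2 and Thm. 7.10: `[ω]` is
the integral class of a hyperplane section). The tree's hard Lefschetz datum `HardLefschetzNFold n X`
(THEOREM `nonempty_hardLefschetzNFold_holds`, "Relies on: nothing unproved") carries exactly these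
fields.

* `exists_isPolarizationClass_mem_algebraicClasses` —
  `IsSmoothProjective n X → ∃ η, IsRationalClass η ∧ η ∈ algebraicClasses X 1 ∧ IsPolarizationClass n X η`.

## References

* C. Voisin, *Hodge Theory and Complex Algebraic Geometry I* (2002), Thm. 6.25, Rem. 6.27, §7.1.2,
  Thm. 7.10. [VoisinHodgeI2002]
* Y. André, *Pour une théorie inconditionnelle des motifs*, Publ. Math. IHÉS 83 (1996), §1.1 (p. 10).
  [Andre1996Motifs]
-/

noncomputable section

open CategoryTheory AlgebraicGeometry

namespace Literature.AlgebraicGeometry.HodgeTheory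

section HodgeTheory

open Literature.AlgebraicGeometry.Motives (IsSmoothProjective)

variable {n : ℕ} {X : Motives.SchemeOver ℂ}

/-- The polarisation class of `exists_isPolarizationClass` with its cycle-theoretic properties
spelled out: on a smooth projective `X` of dimension `n` there is a class `η ∈ H²(X(ℂ); ℂ)` which is
RATIONAL, lies in `N¹ H²(X(ℂ); ℂ) = algebraicClasses X 1` (the `ℂ`-span of divisor classes), and is a
polarisation class (hard Lefschetz in dimension `n`) — the form in which André 1996 §1.1/§2.1 uses
`η_X` ("`L` = cup-produit avec `η_X`", `η_X` the class of an ample invertible sheaf, an algebraic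
cycle class); witness: the hyperplane class of the tree's hard Lefschetz datum
(`nonempty_hardLefschetzNFold_holds`). Relies on: nothing unproved.
[cite: Andre1996Motifs, §1.1 (p. 10)] [cite: VoisinHodgeI2002, §7.1.2 and Thm. 7.10] -/
theorem exists_isPolarizationClass_mem_algebraicClasses (hX : IsSmoothProjective n X) :
    ∃ η : complexBetti X 2,
      IsRationalClass η ∧ η ∈ algebraicClasses X 1 ∧ IsPolarizationClass n X η := by
  obtain ⟨Λ⟩ := nonempty_hardLefschetzNFold_holds n X hX
  exact ⟨Λ.hyperplaneClass, Λ.isRationalClass_hyperplaneClass, Λ.hyperplaneClass_mem,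
    Λ.isPolarizationClass⟩

/-- Sanity link to the sibling file: the existence statement `exists_isPolarizationClass`
(`PolarizationClassExistence`) is recovered from the divisor-class form by forgetting the first two
properties. [cite: VoisinHodgeI2002, Thm. 6.25, Rem. 6.27 and §7.1.2] -/
example (hX : IsSmoothProjective n X) : ∃ η : complexBetti X 2, IsPolarizationClass n X η :=
  exists_isPolarizationClass hX

end HodgeTheory

end Literature.AlgebraicGeometry.HodgeTheory

end

-- buildfix 2026-08-21 (ops-buildfix-2): comment-only re-land to re-queue the hub build of this module
-- (accepted 06:40-07:30Z but never dispatched to the build lane, HOME LEDGER G11b-3); no declaration changed.
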